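import Summits.CriticalPhenomena.PercolationContinuityZ3.Theorems.Transplant.SkelNegBChoiceAll
import HarnessLib

/-!
# N1 (the `{±1}` node), (R) column ((R6a); NEG-SCOPE B.15): **THE STEP-I″ INPUTS AT EVERY CENTRE, SERVED FROM `AtQO` AT THE ROOT** —
# the per-centre inputs consumed by the kit clauses (`hzone/hexit/hbridge/hlong ∀ c`) are the root's inputs transported by the frames: `Skelφ.StepI.oriφ_frame`
# (a `φ`-frame is a frame of every oriented map `oriφ φ b`), `Skelφ.StepI.real_eventNAt_frame₂` (two-map form of `real_eventNAt_frame`: pieces drawn in the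
# ORIENTED map `oriφ φ b`, zone family = the fat seeds of `φ`), and for the choices of record `PlanarSkeletonNeg.NegB.inputsPAt_of_atQOB` /
# `inputsExtraAt_of_atQOB` / `inputsLAt_of_atQOB` / `zoneAt_of_atQOB`: under the node's one-type hypothesis `Φ.types = {t}` every centre `c` receives the
# root's piece-link inputs at every admissible pair and the zone input, as `eventNAt … t c …` — i.e. in the shapes `linkIn (pgramPrism G φ_o c n h (3ℓ) R)
# (Λ c k) (pgSideHalfW/pgTopPieceW G φ_o c …)` and `UniqZone.zone G (Λ c) k M`

builds on p205010 (kernel theorem, internal audit signed; external expert review pending) — nothing in this file uses p205010; nothing here is a claim about the open node.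
Lane `prim-bschramm`, seat `prim-bschramm-p3` (gen 9; design owner + (R) owner); helper file (`--supports stmt-CriticalPhenomena-4575 --as helper`).
[cite: KozmaNitzan2024, §4 pp. 19–21 ((21)–(25): the inputs at every vertex by transitivity), p. 28] [cite: MartineauTassion2017, §3.2]
-/

noncomputable section

open scoped Classical

namespace Summit.CriticalPhenomena.PercolationContinuityZ3.Theorems.Transplant

open MeasureTheory Literature.Probability.Percolation Literature.Probability.LatticeModels SimpleGraph KNCells KNLevels

namespace Skelφ.StepI

open Skelφ

variable {V : Type} {G : SimpleGraph V} {φ : V → Site 2} {types : Finset V}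

/-! ## §1 Frames of the oriented maps; the two-map transport -/

/-- **A `φ`-frame is a frame of every oriented map** `oriφ φ b` (`b = false`: coordinates exchanged). [folklore] -/
theorem oriφ_frame {α : G ≃g G} {t c : V} (hφ : ∀ w, φ (α w) = φ w + (φ c - φ t)) (b : Bool) :
    ∀ w, oriφ φ b (α w) = oriφ φ b w + (oriφ φ b c - oriφ φ b t) := by
  intro w
  cases b
  · rw [oriφ_false]
    funext i
    simp only [trφ_apply, Pi.add_apply, Pi.sub_apply, hφ w]
  · rw [oriφ_true]; exact hφ w

/-- **The realised input at `c` has the probability of the input at `t` — two-map form**: the pieces are drawn in the oriented map `oriφ φ b`, the zone family is the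
fat-seed family of `φ` (`D.Λ = fatSeq`). [cite: KozmaNitzan2024, §4 p. 20 ((22)–(23))] -/
theorem real_eventNAt_frame₂ [Countable V] [G.LocallyFinite] {α : G ≃g G} {t c : V} (hαt : α t = c) (hφ : ∀ w, φ (α w) = φ w + (φ c - φ t))
    (hfr : Frames G φ types) {p : unitInterval} (hC : CylSubcritical G φ types p) (q : unitInterval)
    {D : DataN V} (hD : D.Λ = fatSeq hfr hC) (b : Bool) (x : ℕ × Option (ℕ × Fin 2 × ℤˣ × ℤˣ)) :
    (bondPercolation G q).real (eventNAt G (oriφ φ b) D t c x) = (bondPercolation G q).real (eventN G (oriφ φ b) D (t, x)) := by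
  have hψ := oriφ_frame hφ b
  obtain ⟨M, og⟩ := x
  rcases og with _ | ⟨n, fam, σ, τ⟩
  · rw [eventNAt_none, eventN_none, hD, ← show (fun i => (fatSeq hfr hC t i).image α) = fatSeq hfr hC c from funext (image_frame_fatSeq hαt hφ hfr hC)]
    exact real_zone_image_iso α q _ D.k M
  · rw [eventNAt_some, eventN_some, hD, regionNAt, regionN, ← coe_pgramPrismFin, ← coe_pgramPrismFin, ← image_frame_pgramPrismFin hαt hψ,
      ← image_frame_fatSeq hαt hφ hfr hC D.k]
    unfold pieceNAt pieceN
    split_ifs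
    · rw [← image_frame_pgSideHalfW hαt hψ]; exact real_linkIn_image_iso α q _ _ _
    · rw [← image_frame_pgTopPieceW hαt hψ]; exact real_linkIn_image_iso α q _ _ _

end Skelφ.StepI

/-! ## §2 The inputs of the choices of record at every centre -/

namespace PlanarSkeletonNeg

open SkelConc (Consts)
open Skelφ (oriφ trφ)
open Skelφ.StepI (DataN OutO eventNAt)

namespace NegB

open Neg

section AtQ

variable {κ : Consts} {V : Type} [DecidableEq V] [Countable V] {G : SimpleGraph V} [G.LocallyFinite] {Φ : PlanarSkeletonNeg G} {t : V} {p : unitInterval}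
  {hC : Φ.CylSubcritical p} {gv fv : Neg.FSlot} {Pv : PSlot} {Sv : SSlot} {O : OutO V} {q : unitInterval}

omit [DecidableEq V] [Countable V] in
/-- Under the one-type hypothesis every centre is a frame image of the root. [folklore] -/
theorem exists_frame_of_types_eq (h1 : Φ.types = {t}) (c : V) : ∃ α : G ≃g G, α t = c ∧ ∀ w, Φ.φ (α w) = Φ.φ w + (Φ.φ c - Φ.φ t) := by
  obtain ⟨t', ht', α, hαt, hφ⟩ := Φ.frame c
  rw [h1, Finset.mem_singleton] at ht'
  subst ht'
  exact ⟨α, hαt, hφ⟩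

/-- **The admissible pairs' piece-links AT EVERY CENTRE** (`(M, n) ∈ SMnP`, one vertex type): the input of the root's oriented map `oriφ Φ.φ (O.ori t M n)` realised at `c`.
[cite: KozmaNitzan2024, §4 pp. 19–21 ((21)–(25))] -/
theorem inputsPAt_of_atQOB (hAt : (choiceAtOB κ Φ t p Pv gv fv Sv hC).AtQO O q) (h1 : Φ.types = {t}) (c : V) {M n : ℕ}
    (hMn : (M, n) ∈ SMnP κ Φ t p O.merged (gOf κ Φ t p O gv) (fOf κ Φ t p O fv) Pv) (fam : Fin 2) (σ τ : ℤˣ) :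
    1 - Neg.δI κ Φ < (bondPercolation G q).real (eventNAt G (oriφ Φ.φ (O.ori t M n)) O.merged t c (M, some (n, fam, σ, τ))) := by
  obtain ⟨α, hαt, hφ⟩ := exists_frame_of_types_eq h1 c
  rw [Skelφ.StepI.real_eventNAt_frame₂ hαt hφ Φ.frame hC q (factsO_of_atQOB hAt).1.seed.2.2.2.2 (O.ori t M n)]
  exact inputsP_of_atQOB hAt hMn fam σ τ

/-- **The extra pairs' piece-links at every centre** (`(M, n) ∈ (Pv …).1`: the (R) bridge pair, the kit pair). [this work] -/
theorem inputsExtraAt_of_atQOB (hAt : (choiceAtOB κ Φ t p Pv gv fv Sv hC).AtQO O q) (h1 : Φ.types = {t}) (c : V) {M n : ℕ}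
    (hMn : (M, n) ∈ (Pv κ Φ t p O.merged).1) (fam : Fin 2) (σ τ : ℤˣ) :
    1 - Neg.δI κ Φ < (bondPercolation G q).real (eventNAt G (oriφ Φ.φ (O.ori t M n)) O.merged t c (M, some (n, fam, σ, τ))) :=
  inputsPAt_of_atQOB hAt h1 c (extra_subset_SMnP κ Φ t p O.merged _ _ Pv hMn) fam σ τ

/-- **The long pair's piece-links at every centre** (map `φL`). [this work] -/
theorem inputsLAt_of_atQOB (hAt : (choiceAtOB κ Φ t p Pv gv fv Sv hC).AtQO O q) (h1 : Φ.types = {t}) (c : V) (fam : Fin 2) (σ τ : ℤˣ) :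
    1 - Neg.δI κ Φ <
      (bondPercolation G q).real (eventNAt G (φL κ Φ t p O.D O.DT O.ori (gOf κ Φ t p O gv) (fOf κ Φ t p O fv)) O.merged t c
        (ML κ Φ t p O.merged (gOf κ Φ t p O gv), some (nL κ Φ t p O.merged (gOf κ Φ t p O gv) (fOf κ Φ t p O fv), fam, σ, τ))) :=
  inputsPAt_of_atQOB hAt h1 c (SMn_subset_SMnP κ Φ t p O.merged _ _ Pv (mem_SMn κ Φ t p O.merged (gOf κ Φ t p O gv) (fOf κ Φ t p O fv)).2) fam σ τ

/-- **The uniqueness zone at `M_u` at every centre** (`UniqZone.zone G (O.merged.Λ c) O.merged.k M_u`). [this work] -/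
theorem zoneAt_of_atQOB (hAt : (choiceAtOB κ Φ t p Pv gv fv Sv hC).AtQO O q) (h1 : Φ.types = {t}) (c : V) :
    1 - Neg.δI κ Φ < (bondPercolation G q).real (UniqZone.zone G (O.merged.Λ c) O.merged.k (Mu O.merged)) := by
  obtain ⟨α, hαt, hφ⟩ := exists_frame_of_types_eq h1 c
  have h := Skelφ.StepI.real_eventNAt_frame₂ hαt hφ Φ.frame hC q (factsO_of_atQOB hAt).1.seed.2.2.2.2 true (Mu O.merged, none)
  rw [Skelφ.StepI.eventNAt_none, Skelφ.StepI.eventN_none] at h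
  have hz := zone_of_atQOB hAt
  rw [Skelφ.StepI.eventN_none] at hz
  convert hz.trans_eq h.symm using 3

end AtQ

end NegB

end PlanarSkeletonNeg

end Summit.CriticalPhenomena.PercolationContinuityZ3.Theorems.Transplant

end
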